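import Summits.Ventures.QEC.Census.CertCheckBZAutSound
import Summits.Ventures.QEC.Census.BB.BB144.OrbitBZCover
import Summits.Ventures.QEC.Census.BB.BB144.BZAutData
import Summits.Ventures.QEC.Theorems.BB144DistanceCertificateWeightTwelveZLogical
import Literature.InformationTheory.QuantumCodes.HypergraphProductKernels
import HarnessLib

/-!
# `[[144,12,12]]` — the `bz_aut` LOWER BOUND assembled in the kernel, modulo the per-block enumeration verdicts
# (route BB144DistanceCertificate item NoZLogicalBelowTwelve; PARTITION item 10.BZC; path (b) of record)

Data: `BB144.cert : DistCert` (certA `7c78eb34…`, qec-search-7) and `BB144.bzAutData : BZData` (the ALTERNATIVE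
kernel-A certificate `cert/alt-bzaut/BB144.bzaut.certA.json` `7c1e929a…`, method `bz_aut`: 15 representative
Brouwer–Zimmermann blocks of the `Z` side, parity witness, qec-search-7). This file proves, at tier KERNEL except
for ONE `native_decide` (the label-cover table `coverAut_ok`, flagged), that the fifteen block replays imply the
lower bound:

  `lowerZ_of_blocks : (∀ b < 15, cert.bzZBlock bzAutData b = true) →
     ∀ w, H^X w = 0 → w ∉ rowspace H^Z → 11 < |w|`     (flat indices, the certificate's own matrices),

by `bzAut_lower_sound` (type-10, `Census/CertCheckBZAutSound.lean`) with
* structure: `core_ok` (the two rank certificates — type-02 `RankCert` —, the `LX`/`LZ` pairing, `144 = 66 + 66 + 12`,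
  the parity witness — type-06), `len_ok`, `foundZ_ok` (the 504-entry allow-list decomposes over `H^Z` rows), all
  `decide +kernel`;
* transports = the 72 flat translations of `ℤ₁₂ × ℤ₆` (type-07 `BB.translateFlat`, type-12 `OrbitBZ`): a non-trivial
  `Z`-logical goes to a non-trivial `Z`-logical (`BB.zLogicalFlat_comp_translateFlat_symm`) of the same weight
  (`hammingNorm_comp_equiv`), and its label transforms by `ρ_t = LX · (LZ ∘ σ_t⁻¹)ᵀ` (type-12
  `CSSCode.label_comp_equiv_symm`, with L1 = type-10 `exists_coeffs_of_ker`);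
* cover: type-12's `coverAutOK` over ALL 72 translations (`coverAut_ok`, `native_decide` — tier COMPILED for this
  conjunct) read through `coverAutOK_sound` with the checker's own cover-mask semantics
  (`testBit_coverMask_imp_exists_span`).
The index identity `rowMatrix 144 cert.HX/HZ = BB.bb144.HXFlat/HZFlat` (certificate = generator file = typed code)
and the commutation come from the weight-12 witness closer (`HX_eq_flat`, `HZ_eq_flat`, `comm_flat`). The closer of
the route item imports this file and the emitted verdict files (`cert.bzZSys/bzZEnum/bzZBound`, qec-search-7) and
assembles them with `DistCert.bzZBlock_of_parts`.
-/

namespace Summit.Ventures.QEC.Census.BB144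

open Matrix Literature.InformationTheory.QuantumCodes Literature.InformationTheory.QuantumCodes.BB
  Summit.Ventures.QEC.BB

/-! ## The cheap structural facts (KERNEL) -/

/-- Core structural check of the `Z` side of the `bz_aut` data: rank certificates of `H^X`, `H^Z` (`r = 66` each),
pairing of `LZ`/`LX`, `144 = 66 + 66 + 12`, parity witness (`⊕` of the listed `H^X` rows `= 𝟙`). -/
theorem core_ok : bzCoreOK cert.n cert.HX cert.HZ bzAutData.rcX bzAutData.rcZ bzAutData.LZ bzAutData.LX
    bzAutData.sideZ.evenWitness = true := by
  decide +kernel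

/-- Every matrix of every representative block has `kb = |G_b|` rows. -/
theorem len_ok : cert.bzZLen bzAutData = true := by
  decide +kernel

/-- The `Z` allow-list (504 low-weight stabilizers) decomposes over the rows of `H^Z`. -/
theorem foundZ_ok : foundOK cert.HZ cert.sideZ.found = true := by
  decide +kernel

/-- The pairing check alone (for the label-action lemma). -/
theorem logZ_ok : logOK cert.n cert.HX cert.HZ bzAutData.LZ bzAutData.LX = true := by
  decide +kernel

/-! ## The certificate's code (index identity `rowMatrix 144 cert.HX/HZ = BB.bb144.HXFlat/HZFlat` and commutation
from the weight-12 witness closer: `HX_eq_flat`, `HZ_eq_flat`, `comm_flat`) -/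

/-- The certificate's CSS code on flat indices. -/
abbrev flatCode : CSSCode (Fin cert.HX.length) (Fin cert.HZ.length) (Fin cert.n) :=
  CSSCode.ofMatrices (rowMatrix cert.n cert.HX) (rowMatrix cert.n cert.HZ) comm_flat

/-! ## The label cover by translations (the one COMPILED conjunct) -/

/-- All `72` translations of `ℤ₁₂ × ℤ₆` as pairs `(t₁, t₂)` (the identity included, harmlessly). -/
def taus : List (ℕ × ℕ) := (List.range 12).flatMap fun a => (List.range 6).map fun b => (a, b)

/-- **C5 with automorphisms** (type-12 `coverAutOK`): every nonzero label, or one of its 72 translates, lies in the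
label span of one of the 15 representative blocks. `native_decide`: this conjunct is tier COMPILED / CHECKED-native
(axiom `Lean.ofReduceBool`) — 4095 labels × up to 72 probes, each a 144-bit word transport, is beyond `decide`. -/
theorem coverAut_ok : coverAutOK 12 6 bzAutData.LX bzAutData.LZ taus bzAutData.sideZ.blocks = true := by
  native_decide

/-! ## Assembly -/

/-- The dual (label) matrix `LX` and the logical matrix `LZ` of the `Z` side as matrices over the flat qubits. -/
abbrev LXmat : Matrix (Fin bzAutData.LZ.length) (Fin cert.n) (ZMod 2) := ldMat cert.n bzAutData.LZ bzAutData.LX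

/-- The logical matrix `LZ` (rows `logVec`). -/
abbrev LZmat : Matrix (Fin bzAutData.LZ.length) (Fin cert.n) (ZMod 2) := fun i => logVec cert.n bzAutData.LZ i

/-- The inverse flat translation as a function on the certificate's qubit index type. -/
def sigmaInv (t : Mono 12 6) : Fin cert.n → Fin cert.n := fun q => (BB.translateFlat t).symm q

/-- The pairing in matrix form: `LX · LZᵀ = 1`. -/
theorem LX_mul_LZ_transpose : LXmat * LZmatᵀ = 1 := by
  ext j i
  rw [Matrix.mul_apply', Matrix.one_apply]
  change ldMat cert.n bzAutData.LZ bzAutData.LX j ⬝ᵥ logVec cert.n bzAutData.LZ i = _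
  rw [ldMat, dual_dotProduct_logVec logZ_ok i j]
  by_cases h : i = j
  · subst h; simp
  · rw [if_neg h, if_neg (fun e => h e.symm)]

/-- **The lower bound modulo the block verdicts**: if the fifteen representative `Z` blocks replay
(`cert.bzZBlock bzAutData b = true`, b < 15`; assembled from qec-search-7's `bzZSys`/`bzZEnum`/`bzZBound` files by
`DistCert.bzZBlock_of_parts`), then every non-trivial flat `Z`-logical of the certificate's code has weight `> 11`. -/
theorem lowerZ_of_blocks (hblocks : ∀ b : ℕ, b < bzAutData.sideZ.blocks.length → cert.bzZBlock bzAutData b = true)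
    (w : Fin cert.n → ZMod 2) (hw : rowMatrix cert.n cert.HX *ᵥ w = 0)
    (hw' : w ∉ rowSpace (rowMatrix cert.n cert.HZ)) : cert.dZ - 1 < hammingNorm w := by
  -- structural facts unpacked once
  have hcore := core_ok
  simp only [bzCoreOK, Bool.and_eq_true, beq_iff_eq] at hcore
  obtain ⟨⟨⟨⟨hY, hS⟩, hL⟩, hdim⟩, -⟩ := hcore
  -- the label-action ingredients
  have hLX : ∀ a, flatCode.HZ *ᵥ LXmat a = 0 := fun a => mulVec_dual_eq_zero hL a
  have hexp : ∀ z, flatCode.HX *ᵥ z = 0 → z - (LXmat *ᵥ z) ᵥ* LZmat ∈ flatCode.rowSpZ := fun z hz =>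
    flatCode.sub_label_vecMul_mem_rowSpZ hLX LX_mul_LZ_transpose (exists_coeffs_of_ker comm_flat hY hS hL hdim hz)
  refine bzAut_lower_sound (s := bzAutData.sideZ) comm_flat foundZ_ok core_ok len_ok hblocks
    (α := {t : Mono 12 6 // (((t.1 : Fin 12) : ℕ), ((t.2 : Fin 6) : ℕ)) ∈ taus})
    (fun a z => z ∘ sigmaInv a.1)
    (fun a => LXmat * (LZmat.submatrix id (sigmaInv a.1))ᵀ)
    (fun a z hz hz' => ?_) (fun lam hlam => ?_) w hw hw'
  · -- transport by the translation `a.1`: row-map automorphism facts on the certificate's matrices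
    have hXsub : flatCode.HX.submatrix (BB.checkTranslateFlat a.1) (BB.translateFlat a.1) = flatCode.HX := by
      have h := BB.HXFlat_submatrix_translateFlat BB.bb144 a.1
      rw [← HX_eq_flat] at h
      exact h
    have hZsub : flatCode.HZ.submatrix (BB.checkTranslateFlat a.1) (BB.translateFlat a.1) = flatCode.HZ := by
      have h := BB.HZFlat_submatrix_translateFlat BB.bb144 a.1
      rw [← HZ_eq_flat] at h
      exact h
    obtain ⟨h1, h2⟩ := flatCode.zLogical_comp_equiv_symm_of_rowMap hXsub hZsub ⟨hz, hz'⟩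
    exact ⟨h1, h2, hammingNorm_comp_equiv z (BB.translateFlat a.1 : Fin cert.n ≃ Fin cert.n),
      flatCode.label_comp_equiv_symm hLX hexp hZsub hz⟩
  · -- cover by translates
    rcases coverAutOK_sound (ℓ := 12) (m := 6) coverAut_ok
        (P := fun μ => ∃ b : Fin bzAutData.sideZ.blocks.length, μ ∈ Submodule.span (ZMod 2)
          (Set.range fun l : Fin (bzAutData.sideZ.blocks[b]).W.length =>
            ofBits bzAutData.LZ.length (bzAutData.sideZ.blocks[b]).W[l]))
        (fun v hv => testBit_coverMask_imp_exists_span _ _ hv)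
        (Ld' := LXmat) (L' := LZmat) (fun i => rfl)
        (fun j => by
          change ofBits cert.n bzAutData.LZ[j] = ofBits cert.n (bzAutData.LZ.getD j 0)
          rw [List.getD_eq_getElem?_getD, List.getElem?_eq_getElem j.2, Option.getD_some]
          rfl)
        lam hlam with hP | ⟨t, ht, hPt⟩
    · exact Or.inl hP
    · obtain ⟨b, hb⟩ := hPt
      exact Or.inr ⟨⟨t, ht⟩, b, hb⟩

/-- The same bound as `12 ≤ |w|` (`cert.dZ = 12`). -/
theorem twelve_le_of_blocks (hblocks : ∀ b : ℕ, b < bzAutData.sideZ.blocks.length → cert.bzZBlock bzAutData b = true)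
    (w : Fin cert.n → ZMod 2) (hw : rowMatrix cert.n cert.HX *ᵥ w = 0)
    (hw' : w ∉ rowSpace (rowMatrix cert.n cert.HZ)) : 12 ≤ hammingNorm w := by
  have := lowerZ_of_blocks hblocks w hw hw'
  change 12 - 1 < hammingNorm w at this
  omega

end Summit.Ventures.QEC.Census.BB144
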